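import Literature.NumberTheory.EllipticCurves.ComplexMultiplicationShaLocalProofs
import Literature.NumberTheory.EllipticCurves.ComplexMultiplicationLocalFactors12
import Literature.NumberTheory.EllipticCurves.ComplexMultiplicationLocalFactors16
import Literature.NumberTheory.EllipticCurves.ComplexMultiplicationLocalFactors27
import Literature.NumberTheory.EllipticCurves.ComplexMultiplicationLocalFactors28
import Literature.NumberTheory.EllipticCurves.LFunctionSmulProofs
import HarnessLib

/-!
# bsd.S28 (Rubin): finiteness of `Ш(E/ℚ)` for CM curves with `L(E,1) ≠ 0` — level 5:
# Knapp's Theorem 11.67 for the isogenies that occur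

Fifth level of the decomposition of `Literature.NumberTheory.EllipticCurves.shaFinite_of_hasCM_of_L_one_ne_zero` (bsd.S28, `Ш`
part; Rubin, Invent. Math. 89 (1987), §0 Remark (3): *"If `E` is defined over `ℚ`, has CM by
`K`, and `L(E/ℚ, 1) ≠ 0`, then `Ш(E/ℚ)` is finite"*). Level 4
(`ComplexMultiplicationShaLocalProofs.lean`) derived the target from six printed statements, the
sixth being Knapp's Theorem 11.67 (`Literature.NumberTheory.EllipticCurves.LFunction_eq_of_isIsogenous`: isogenous elliptic
curves over `ℚ` have the same `L`-function), used once: to move the hypothesis `L(E, 1) ≠ 0`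
along the `ℚ`-isogeny `E → E'` from CM by a non-maximal order to CM by the maximal order
(Rubin 1987, §10, p. 548, over `ℚ`). The isogenies that occur are explicit — the table of
`ComplexMultiplicationMaximalOrderProofs.lean`, i.e. Silverman's `2`-isogenies for
`j = 54000, 287496, 16581375` and Vélu's `3`-isogeny for `j = -12288000`, transported along `j` by
changes of variables and quadratic twists — and for exactly these four isogeny classes *and all
their quadratic twists* the sibling files `ComplexMultiplicationLocalFactors12/16/27/28.lean`
prove Knapp's theorem prime by prime for Mathlib's `WeierstrassCurve.LFunction`
(`LFunction_cm12_eq`, `LFunction_cm16_eq`, `LFunction_cm27_eq`, `LFunction_cm28_eq`: equal local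
polynomials at every finite place, for the twist families `E_d`, `E'_d` over `ℤ`, `d` squarefree).

This file reruns the table of level 4 keeping track of the `L`-function as well as of the local
points maps, and so removes the sixth leaf: `shaFinite_of_hasCM_of_L_one_ne_zero_of_level5`
derives the target, sorry-free, from the **five** printed statements

1. Rubin 1987, Thm. 6.6 for `E_K` (`Rubin1987_sha_torsionBy_eq_bot_cofinite`);
2. Rubin 1987, §10: `Ш(E_K/K)_{𝔭^∞}` finite (`Rubin1987_sha_primary_finite`);
3. Deuring, `L(E_K/K, s) = L(E/ℚ, s)²` (`Deuring_LFunction_baseChange_cmField`);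
4. modularity (`hasEntireLFunction_rat`);
5. the classification of rational CM `j`-invariants (`hasCM_iff_j_mem`, Heegner–Baker–Stark),

everything else in Remark (3)'s reduction to Theorem A for `E_K` with CM by `𝓞_K` being proved in
the tree (levels 1–4, `ShaTorsion`, `ShaIsogeny`, `IsogenyLocalPointsMaps`, the four
`…LocalFactors…` files and `LFunctionSmulProofs`).

The new elementary inputs: a nonzero rational number is a squarefree integer times a square
(`Rat.exists_eq_squarefree_intCast_mul_sq`), so a curve with `j(W) = j(E) ≠ 0, 1728` is
`ℚ`-isomorphic to `E^{(d)}` with `d` a *squarefree integer*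
(`exists_variableChange_eq_quadraticTwist_intCast_of_j_eq`; Silverman, *AEC*, X.5 Cor. 5.4.1);
the twist families `E_d`, `E'_d` of the sibling files are, over `ℚ`, the quadratic twists
`E^{(d)}`, resp. `⟨2, 0, 0, 0⟩ • E'^{(d)}` (`E'^{(d)}` for the Vélu class), of the table's models
(`map_cm…Model_eq_quadraticTwist`, `map_cm…Codomain_eq_…`); and the `L`-function is an
isomorphism invariant (`WeierstrassCurve.LFunction_smul`, Silverman *AEC* App. C §16 with
VII.1.3(b), proved in `LFunctionSmulProofs`).

## Main statements

* `exists_isLocIsogenous_LFunction_eq_of_j_eq`: transport along `j` of an isogeny with local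
  points maps *and* of the equality of `L`-functions of all squarefree twists.
* `LFunction_quadraticTwist_cm12_eq` / `…cm16…` / `…cm27…` / `…cm28…`: Knapp 11.67 for the
  squarefree twists of the four table isogenies (from the sibling files).
* `exists_isLocIsogenous_LFunction_eq_j_mem_maximalCMJInvariants_of_j_mem_nonmaximalCMJInvariants`:
  the table — every `E/ℚ` with `j ∈ {54000, 287496, -12288000, 16581375}` is joined to some `E'`
  with `j(E') ∈ maximalCMJInvariants` by a `ℚ`-isogeny with local points maps, and
  `L(E, s) = L(E', s)`.
* `shaFinite_of_hasCM_of_L_one_ne_zero_of_maximalOrder_of_hasCM_iff_j_mem`: the `HasCM` form of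
  bsd.S28 (`Ш` part) from its maximal-order case and `hasCM_iff_j_mem` alone.
* `shaFinite_of_hasCM_of_L_one_ne_zero_of_level5`: the target from leaves 1–5.

## References

* K. Rubin, *Tate–Shafarevich groups and L-functions of elliptic curves with complex
  multiplication*, Invent. Math. 89 (1987), §0 Remark (3), §10 (p. 548). [Rubin1987Sha]
* A. W. Knapp, *Elliptic Curves*, Math. Notes 40, Princeton 1992, Thm. 11.67 (PDF p. 281).
  [Knapp1993]
* J. S. Milne, *Arithmetic Duality Theorems*, 2nd ed. (2006), Ch. I Lemma 7.1(b). [MilneADT2006]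
* J. H. Silverman, *The Arithmetic of Elliptic Curves*, 2nd ed. (2009), III.4.5, X.5 Cor. 5.4.1,
  App. C §16. [SilvermanAEC2009]
* J. H. Silverman, *Advanced Topics in the Arithmetic of Elliptic Curves* (1994), II
  Exercise 2.12(b), App. A §3. [SilvermanAdvancedTopics1994]
-/

noncomputable section

open scoped Classical

open WeierstrassCurve

namespace Literature.NumberTheory.EllipticCurves

/-! ## Squarefree integral twisting parameters -/

/-- Every nonzero rational number is a squarefree integer times a nonzero rational square,
`d = d₀ e²` (write `num(d) · den(d) = ± b² a` with `a` squarefree, `Nat.sq_mul_squarefree_of_pos`;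
then `d = (± a) · (b / den(d))²`). [folklore] -/
theorem Rat.exists_eq_squarefree_intCast_mul_sq {d : ℚ} (hd : d ≠ 0) :
    ∃ (d₀ : ℤ) (e : ℚ), d₀ ≠ 0 ∧ Squarefree d₀ ∧ e ≠ 0 ∧ (d₀ : ℚ) * e ^ 2 = d := by
  have hnum : d.num ≠ 0 := Rat.num_ne_zero.2 hd
  have hden : (d.den : ℤ) ≠ 0 := Int.natCast_ne_zero.2 d.den_nz
  have hm : d.num * d.den ≠ 0 := mul_ne_zero hnum hden
  obtain ⟨a, b, ha, hb, hab, hsq⟩ :=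
    Nat.sq_mul_squarefree_of_pos (Int.natAbs_pos.2 hm)
  refine ⟨d.num.sign * a, (b : ℚ) / d.den, ?_, ?_, ?_, ?_⟩
  · refine mul_ne_zero (fun h ↦ hnum (Int.sign_eq_zero_iff_zero.1 h)) (Int.natCast_ne_zero.2 ha.ne')
  · rw [← Int.squarefree_natAbs, Int.natAbs_mul, Int.natAbs_sign_of_ne_zero hnum, one_mul,
      Int.natAbs_natCast]
    exact hsq
  · exact div_ne_zero (Nat.cast_ne_zero.2 hb.ne') (Nat.cast_ne_zero.2 d.den_nz)
  · have hZ : d.num * d.den = d.num.sign * ((b : ℤ) ^ 2 * a) := by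
      have h1 : ((d.num * d.den).natAbs : ℤ) = (b : ℤ) ^ 2 * a := by exact_mod_cast hab.symm
      rw [← h1, Int.natAbs_mul, Int.natCast_mul, Int.natAbs_natCast, Int.natCast_natAbs,
        ← mul_assoc, Int.sign_mul_abs]
    have hQ : (d.num : ℚ) * d.den = d.num.sign * ((b : ℚ) ^ 2 * a) := by exact_mod_cast hZ
    have hdn : (d.den : ℚ) ≠ 0 := Nat.cast_ne_zero.2 d.den_nz
    have key : ((d.num.sign * a : ℤ) : ℚ) * ((b : ℚ) / d.den) ^ 2 * d.den = d.num := by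
      have h2 : ((d.num.sign * a : ℤ) : ℚ) * ((b : ℚ) / d.den) ^ 2 * d.den * d.den =
          d.num * d.den := by
        rw [hQ]; push_cast; field_simp
      exact mul_right_cancel₀ hdn h2
    calc ((d.num.sign * a : ℤ) : ℚ) * ((b : ℚ) / d.den) ^ 2
        = ((d.num.sign * a : ℤ) : ℚ) * ((b : ℚ) / d.den) ^ 2 * d.den / d.den :=
          (mul_div_cancel_right₀ _ hdn).symm
      _ = (d.num : ℚ) / (d.den : ℚ) := by rw [key]
      _ = d := Rat.num_div_den d

/-- **Transport along `j` with a squarefree integral twisting parameter**: if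
`j(W) = j(E) ≠ 0, 1728` then `C • W = E^{(d)}` for some squarefree integer `d ≠ 0` and some
change of variables `C` over `ℚ` (`exists_variableChange_eq_quadraticTwist_of_j_eq`, then
`d = d₀ e²` and `E^{(d₀)} ≅ E^{(d₀ e²)}`, `exists_variableChange_quadraticTwist_mul_sq`).
Silverman, *AEC*, X.5 Prop. 5.4 and Cor. 5.4.1 (the twists of `E` with `j ≠ 0, 1728` are the
`E_D`, `D ∈ ℚ^*/(ℚ^*)²`, and every class has a squarefree integral representative).
[cite: SilvermanAEC2009, X.5 Prop. 5.4 and Cor. 5.4.1] -/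
theorem exists_variableChange_eq_quadraticTwist_intCast_of_j_eq {W E : WeierstrassCurve ℚ}
    [W.IsElliptic] [E.IsElliptic] (hj : W.j = E.j) (h0 : E.j ≠ 0) (h1728 : E.j ≠ 1728) :
    ∃ d : ℤ, d ≠ 0 ∧ Squarefree d ∧ ∃ C : VariableChange ℚ, C • W = E.quadraticTwist (d : ℚ) := by
  obtain ⟨d, hd, C, hC⟩ := exists_variableChange_eq_quadraticTwist_of_j_eq hj h0 h1728
  obtain ⟨d₀, e, hd₀, hsq, he, rfl⟩ := Rat.exists_eq_squarefree_intCast_mul_sq hd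
  obtain ⟨C', hC'⟩ := E.exists_variableChange_quadraticTwist_mul_sq (d₀ : ℚ) e he
  refine ⟨d₀, hd₀, hsq, C'⁻¹ * C, ?_⟩
  rw [mul_smul, hC, ← hC', inv_smul_smul]

/-- **Transport of an isogeny with local points maps and equal `L`-functions along `j`.**
If `j(W) = j(E) ≠ 0, 1728`, `E ~ E'` with local points maps, and the quadratic twists of `E` and
`E'` by every squarefree integer `d ≠ 0` have the same `L`-function, then for some `W'` with
`j(W') = j(E')` we have `W ~ W'` with local points maps and `L(W, s) = L(W', s)` — namely
`W' = E'^{(d)}` for the squarefree `d` with `C • W = E^{(d)}`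
(`exists_variableChange_eq_quadraticTwist_intCast_of_j_eq`), by `isLocIsogenous_smul`,
`IsLocIsogenous.quadraticTwist` and the isomorphism invariance `LFunction_smul` of `L`.
[cite: SilvermanAEC2009, X.5 Cor. 5.4.1 and App. C §16] -/
theorem exists_isLocIsogenous_LFunction_eq_of_j_eq {W E E' : WeierstrassCurve ℚ} [W.IsElliptic]
    [E.IsElliptic] [E'.IsElliptic] (hj : W.j = E.j) (h0 : E.j ≠ 0) (h1728 : E.j ≠ 1728)
    (hiso : IsLocIsogenous E E')
    (hL : ∀ d : ℤ, d ≠ 0 → Squarefree d →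
      (E.quadraticTwist (d : ℚ)).LFunction = (E'.quadraticTwist (d : ℚ)).LFunction) :
    ∃ (W' : WeierstrassCurve ℚ) (_ : W'.IsElliptic),
      IsLocIsogenous W W' ∧ W.LFunction = W'.LFunction ∧ W'.j = E'.j := by
  obtain ⟨d, hd, hsq, C, hC⟩ := exists_variableChange_eq_quadraticTwist_intCast_of_j_eq hj h0 h1728
  have hdQ : (d : ℚ) ≠ 0 := Int.cast_ne_zero.2 hd
  haveI := E'.isElliptic_quadraticTwist hdQ
  refine ⟨E'.quadraticTwist d, ‹_›, ?_, ?_, E'.j_quadraticTwist hdQ⟩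
  · have h1 : IsLocIsogenous W (C • W) := isLocIsogenous_smul W C
    rw [hC] at h1
    exact h1.trans' (hiso.quadraticTwist hdQ)
  · rw [← LFunction_smul W C, hC, hL d hd hsq]

/-! ## The twist families of the sibling files are the quadratic twists of the table's models -/

/-- `E_d = [0, 6d, 0, -3d², 0]` (`cm12Model d` over `ℚ`) is the quadratic twist of
`[0, 6, 0, -3, 0]` by `d`. [folklore] -/
theorem map_cm12Model_eq_quadraticTwist (d : ℤ) :
    (cm12Model d).map (Int.castRingHom ℚ) =
      (⟨0, 6, 0, -3, 0⟩ : WeierstrassCurve ℚ).quadraticTwist (d : ℚ) := by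
  rw [map_cm12Model]
  ext
  · rfl
  · simp only [quadraticTwist_a₂, b₂]; ring
  · rfl
  · simp only [quadraticTwist_a₄, b₄]; ring
  · simp only [quadraticTwist_a₆, b₆]; ring

/-- `E'_d = [0, -3d, 0, 3d², 0]` (`cm12Codomain d` over `ℚ`) is `⟨2, 0, 0, 0⟩ • [0, -12, 0, 48, 0]^{(d)}`,
the rescaled twist of Silverman's `2`-isogeny codomain. [folklore] -/
theorem map_cm12Codomain_eq_smul_quadraticTwist (d : ℤ) :
    (cm12Codomain d).map (Int.castRingHom ℚ) =
      (⟨Units.mk0 2 two_ne_zero, 0, 0, 0⟩ : VariableChange ℚ) •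
        (⟨0, -12, 0, 48, 0⟩ : WeierstrassCurve ℚ).quadraticTwist (d : ℚ) := by
  rw [map_cm12Codomain]
  ext
  · simp [variableChange_a₁]
  · simp only [variableChange_a₂, quadraticTwist_a₁, quadraticTwist_a₂, b₂, Units.val_inv_eq_inv_val,
      Units.val_mk0]
    ring
  · simp [variableChange_a₃]
  · simp only [variableChange_a₄, quadraticTwist_a₁, quadraticTwist_a₃, quadraticTwist_a₄, b₄,
      Units.val_inv_eq_inv_val, Units.val_mk0]
    ring
  · simp only [variableChange_a₆, quadraticTwist_a₁, quadraticTwist_a₂, quadraticTwist_a₃,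
      quadraticTwist_a₄, quadraticTwist_a₆, b₂, b₄, b₆, Units.val_inv_eq_inv_val, Units.val_mk0]
    ring

/-- `E_d = [0, -6d, 0, d², 0]` (`cm16Model d` over `ℚ`) is the quadratic twist of
`[0, -6, 0, 1, 0]` by `d`. [folklore] -/
theorem map_cm16Model_eq_quadraticTwist (d : ℤ) :
    (cm16Model d).map (Int.castRingHom ℚ) =
      (⟨0, -6, 0, 1, 0⟩ : WeierstrassCurve ℚ).quadraticTwist (d : ℚ) := by
  rw [map_cm16Model]
  ext
  · rfl
  · simp only [quadraticTwist_a₂, b₂]; ring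
  · rfl
  · simp only [quadraticTwist_a₄, b₄]; ring
  · simp only [quadraticTwist_a₆, b₆]; ring

/-- `E'_d = [0, 3d, 0, 2d², 0]` (`cm16Codomain d` over `ℚ`) is `⟨2, 0, 0, 0⟩ • [0, 12, 0, 32, 0]^{(d)}`.
[folklore] -/
theorem map_cm16Codomain_eq_smul_quadraticTwist (d : ℤ) :
    (cm16Codomain d).map (Int.castRingHom ℚ) =
      (⟨Units.mk0 2 two_ne_zero, 0, 0, 0⟩ : VariableChange ℚ) •
        (⟨0, 12, 0, 32, 0⟩ : WeierstrassCurve ℚ).quadraticTwist (d : ℚ) := by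
  rw [map_cm16Codomain]
  ext
  · simp [variableChange_a₁]
  · simp only [variableChange_a₂, quadraticTwist_a₁, quadraticTwist_a₂, b₂, Units.val_inv_eq_inv_val,
      Units.val_mk0]
    ring
  · simp [variableChange_a₃]
  · simp only [variableChange_a₄, quadraticTwist_a₁, quadraticTwist_a₃, quadraticTwist_a₄, b₄,
      Units.val_inv_eq_inv_val, Units.val_mk0]
    ring
  · simp only [variableChange_a₆, quadraticTwist_a₁, quadraticTwist_a₂, quadraticTwist_a₃,
      quadraticTwist_a₄, quadraticTwist_a₆, b₂, b₄, b₆, Units.val_inv_eq_inv_val, Units.val_mk0]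
    ring

/-- `E_d = [0, 36d, 0, -48d², 16d³]` (`cm27Model d` over `ℚ`) is the quadratic twist of
`E_{6,-4} = [0, 36, 0, -48, 16]` (`threeTorsionModel 6 (-4)`) by `d`. [folklore] -/
theorem map_cm27Model_eq_quadraticTwist (d : ℤ) :
    (cm27Model d).map (Int.castRingHom ℚ) =
      (threeTorsionModel (6 : ℚ) (-4)).quadraticTwist (d : ℚ) := by
  rw [map_cm27Model]
  ext
  · rfl
  · simp only [quadraticTwist_a₂, b₂, threeTorsionModel_a₁, threeTorsionModel_a₂]; ring
  · rfl
  · simp only [quadraticTwist_a₄, b₄, threeTorsionModel_a₁, threeTorsionModel_a₃,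
      threeTorsionModel_a₄]; ring
  · simp only [quadraticTwist_a₆, b₆, threeTorsionModel_a₃, threeTorsionModel_a₆]; ring

/-- `E'_d = [0, 36d, 0, 432d², 13392d³]` (`cm27Codomain d` over `ℚ`) is the quadratic twist of
Vélu's quotient `E'_{6,-4} = [0, 36, 0, 432, 13392]` (`threeIsogenyCodomain 6 (-4)`) by `d`.
[folklore] -/
theorem map_cm27Codomain_eq_quadraticTwist (d : ℤ) :
    (cm27Codomain d).map (Int.castRingHom ℚ) =
      (threeIsogenyCodomain (6 : ℚ) (-4)).quadraticTwist (d : ℚ) := by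
  rw [map_cm27Codomain]
  ext
  · rfl
  · simp only [quadraticTwist_a₂, b₂, threeIsogenyCodomain_a₁, threeIsogenyCodomain_a₂]; ring
  · rfl
  · simp only [quadraticTwist_a₄, b₄, threeIsogenyCodomain_a₁, threeIsogenyCodomain_a₃,
      threeIsogenyCodomain_a₄]; ring
  · simp only [quadraticTwist_a₆, b₆, threeIsogenyCodomain_a₃, threeIsogenyCodomain_a₆]; ring

/-- `E_d = [0, -42d, 0, -7d², 0]` (`cm28Model d` over `ℚ`) is the quadratic twist of
`[0, -42, 0, -7, 0]` by `d`. [folklore] -/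
theorem map_cm28Model_eq_quadraticTwist (d : ℤ) :
    (cm28Model d).map (Int.castRingHom ℚ) =
      (⟨0, -42, 0, -7, 0⟩ : WeierstrassCurve ℚ).quadraticTwist (d : ℚ) := by
  rw [map_cm28Model]
  ext
  · rfl
  · simp only [quadraticTwist_a₂, b₂]; ring
  · rfl
  · simp only [quadraticTwist_a₄, b₄]; ring
  · simp only [quadraticTwist_a₆, b₆]; ring

/-- `E'_d = [0, 21d, 0, 112d², 0]` (`cm28Codomain d` over `ℚ`) is
`⟨2, 0, 0, 0⟩ • [0, 84, 0, 1792, 0]^{(d)}`. [folklore] -/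
theorem map_cm28Codomain_eq_smul_quadraticTwist (d : ℤ) :
    (cm28Codomain d).map (Int.castRingHom ℚ) =
      (⟨Units.mk0 2 two_ne_zero, 0, 0, 0⟩ : VariableChange ℚ) •
        (⟨0, 84, 0, 1792, 0⟩ : WeierstrassCurve ℚ).quadraticTwist (d : ℚ) := by
  rw [map_cm28Codomain]
  ext
  · simp [variableChange_a₁]
  · simp only [variableChange_a₂, quadraticTwist_a₁, quadraticTwist_a₂, b₂, Units.val_inv_eq_inv_val,
      Units.val_mk0]
    ring
  · simp [variableChange_a₃]
  · simp only [variableChange_a₄, quadraticTwist_a₁, quadraticTwist_a₃, quadraticTwist_a₄, b₄,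
      Units.val_inv_eq_inv_val, Units.val_mk0]
    ring
  · simp only [variableChange_a₆, quadraticTwist_a₁, quadraticTwist_a₂, quadraticTwist_a₃,
      quadraticTwist_a₄, quadraticTwist_a₆, b₂, b₄, b₆, Units.val_inv_eq_inv_val, Units.val_mk0]
    ring

/-! ## Knapp 11.67 for the squarefree twists of the four table isogenies -/

/-- **`L([0,6,0,-3,0]^{(d)}, s) = L([0,-12,0,48,0]^{(d)}, s)`** for squarefree `d ≠ 0`
(`j = 54000 ~ 0`): `LFunction_cm12_eq` moved across the model identities and `LFunction_smul`.
[cite: Knapp1993, Thm. 11.67 (PDF p. 281)] -/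
theorem LFunction_quadraticTwist_cm12_eq {d : ℤ} (hd : d ≠ 0) (hsq : Squarefree d) :
    ((⟨0, 6, 0, -3, 0⟩ : WeierstrassCurve ℚ).quadraticTwist (d : ℚ)).LFunction =
      ((⟨0, -12, 0, 48, 0⟩ : WeierstrassCurve ℚ).quadraticTwist (d : ℚ)).LFunction := by
  have hdQ : (d : ℚ) ≠ 0 := Int.cast_ne_zero.2 hd
  haveI := (⟨0, -12, 0, 48, 0⟩ : WeierstrassCurve ℚ).isElliptic_quadraticTwist hdQ
  rw [← map_cm12Model_eq_quadraticTwist, LFunction_cm12_eq hsq,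
    map_cm12Codomain_eq_smul_quadraticTwist, LFunction_smul]

/-- **`L([0,-6,0,1,0]^{(d)}, s) = L([0,12,0,32,0]^{(d)}, s)`** for squarefree `d ≠ 0`
(`j = 287496 ~ 1728`), from `LFunction_cm16_eq`. [cite: Knapp1993, Thm. 11.67 (PDF p. 281)] -/
theorem LFunction_quadraticTwist_cm16_eq {d : ℤ} (hd : d ≠ 0) (hsq : Squarefree d) :
    ((⟨0, -6, 0, 1, 0⟩ : WeierstrassCurve ℚ).quadraticTwist (d : ℚ)).LFunction =
      ((⟨0, 12, 0, 32, 0⟩ : WeierstrassCurve ℚ).quadraticTwist (d : ℚ)).LFunction := by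
  have hdQ : (d : ℚ) ≠ 0 := Int.cast_ne_zero.2 hd
  haveI := (⟨0, 12, 0, 32, 0⟩ : WeierstrassCurve ℚ).isElliptic_quadraticTwist hdQ
  rw [← map_cm16Model_eq_quadraticTwist, LFunction_cm16_eq hd hsq,
    map_cm16Codomain_eq_smul_quadraticTwist, LFunction_smul]

/-- **`L(E_{6,-4}^{(d)}, s) = L(E'_{6,-4}^{(d)}, s)`** for squarefree `d`
(`j = -12288000 ~ 0`), from `LFunction_cm27_eq`. [cite: Knapp1993, Thm. 11.67 (PDF p. 281)] -/
theorem LFunction_quadraticTwist_cm27_eq {d : ℤ} (hsq : Squarefree d) :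
    ((threeTorsionModel (6 : ℚ) (-4)).quadraticTwist (d : ℚ)).LFunction =
      ((threeIsogenyCodomain (6 : ℚ) (-4)).quadraticTwist (d : ℚ)).LFunction := by
  rw [← map_cm27Model_eq_quadraticTwist, LFunction_cm27_eq hsq, map_cm27Codomain_eq_quadraticTwist]

/-- **`L([0,-42,0,-7,0]^{(d)}, s) = L([0,84,0,1792,0]^{(d)}, s)`** for squarefree `d ≠ 0`
(`j = 16581375 ~ -3375`), from `LFunction_cm28_eq`. [cite: Knapp1993, Thm. 11.67 (PDF p. 281)] -/
theorem LFunction_quadraticTwist_cm28_eq {d : ℤ} (hd : d ≠ 0) (hsq : Squarefree d) :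
    ((⟨0, -42, 0, -7, 0⟩ : WeierstrassCurve ℚ).quadraticTwist (d : ℚ)).LFunction =
      ((⟨0, 84, 0, 1792, 0⟩ : WeierstrassCurve ℚ).quadraticTwist (d : ℚ)).LFunction := by
  have hdQ : (d : ℚ) ≠ 0 := Int.cast_ne_zero.2 hd
  haveI := (⟨0, 84, 0, 1792, 0⟩ : WeierstrassCurve ℚ).isElliptic_quadraticTwist hdQ
  rw [← map_cm28Model_eq_quadraticTwist, LFunction_cm28_eq hsq,
    map_cm28Codomain_eq_smul_quadraticTwist, LFunction_smul]

/-! ## The table, with local points maps and equal `L`-functions -/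

/-- **The table of `ℚ`-isogenies to maximal order, with local points maps and equal
`L`-functions.** Every elliptic curve over `ℚ` with `j ∈ {54000, 287496, -12288000, 16581375}`
(CM by an order of conductor `2, 2, 3, 2`) is joined to one with `j ∈ maximalCMJInvariants`
(namely `j = 0, 1728, 0, -3375`) by a `ℚ`-isogeny *with local points maps* along which the
`L`-function is unchanged: the table of
`exists_isIsogenous_j_mem_maximalCMJInvariants_of_j_mem_nonmaximalCMJInvariants_holds`
(Silverman, *Advanced Topics*, Exercise 2.12(b), App. A §3) rerun through
`exists_isLocIsogenous_LFunction_eq_of_j_eq` with the four proved instances of Knapp 11.67.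
[cite: SilvermanAdvancedTopics1994, Exercise 2.12(b) and App. A §3]
[cite: Knapp1993, Thm. 11.67 (PDF p. 281)] -/
theorem exists_isLocIsogenous_LFunction_eq_j_mem_maximalCMJInvariants_of_j_mem_nonmaximalCMJInvariants
    (W : WeierstrassCurve ℚ) [W.IsElliptic] (hj : W.j ∈ nonmaximalCMJInvariants) :
    ∃ (W' : WeierstrassCurve ℚ) (_ : W'.IsElliptic),
      IsLocIsogenous W W' ∧ W.LFunction = W'.LFunction ∧ W'.j ∈ maximalCMJInvariants := by
  simp only [nonmaximalCMJInvariants, Finset.mem_insert, Finset.mem_singleton] at hj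
  rcases hj with hj | hj | hj | hj
  · -- `j = 54000 ~ 0`
    obtain ⟨W', hW', hiso, hL, hjW'⟩ := exists_isLocIsogenous_LFunction_eq_of_j_eq (W := W)
      (by rw [hj, j_cm12]) (by rw [j_cm12]; norm_num) (by rw [j_cm12]; norm_num) isLocIsogenous_cm12
      (fun d hd hsq ↦ LFunction_quadraticTwist_cm12_eq hd hsq)
    exact ⟨W', hW', hiso, hL, by rw [hjW', j_cm12']; decide⟩
  · -- `j = 287496 ~ 1728`
    obtain ⟨W', hW', hiso, hL, hjW'⟩ := exists_isLocIsogenous_LFunction_eq_of_j_eq (W := W)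
      (by rw [hj, j_cm16]) (by rw [j_cm16]; norm_num) (by rw [j_cm16]; norm_num) isLocIsogenous_cm16
      (fun d hd hsq ↦ LFunction_quadraticTwist_cm16_eq hd hsq)
    exact ⟨W', hW', hiso, hL, by rw [hjW', j_cm16']; decide⟩
  · -- `j = -12288000 ~ 0`
    haveI := isElliptic_threeIsogenyCodomain (m := (6 : ℚ)) (s := -4)
    obtain ⟨W', hW', hiso, hL, hjW'⟩ := exists_isLocIsogenous_LFunction_eq_of_j_eq (W := W)
      (E := threeTorsionModel (6 : ℚ) (-4)) (E' := threeIsogenyCodomain (6 : ℚ) (-4))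
      (by rw [hj, j_threeTorsionModel_cm27]) (by rw [j_threeTorsionModel_cm27]; norm_num)
      (by rw [j_threeTorsionModel_cm27]; norm_num) isLocIsogenous_cm27
      (fun d _ hsq ↦ LFunction_quadraticTwist_cm27_eq hsq)
    exact ⟨W', hW', hiso, hL, by rw [hjW', j_threeIsogenyCodomain_cm27]; decide⟩
  · -- `j = 16581375 ~ -3375`
    obtain ⟨W', hW', hiso, hL, hjW'⟩ := exists_isLocIsogenous_LFunction_eq_of_j_eq (W := W)
      (by rw [hj, j_cm28]) (by rw [j_cm28]; norm_num) (by rw [j_cm28]; norm_num) isLocIsogenous_cm28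
      (fun d hd hsq ↦ LFunction_quadraticTwist_cm28_eq hd hsq)
    exact ⟨W', hW', hiso, hL, by rw [hjW', j_cm28']; decide⟩

/-- **The `HasCM` form**: given the classification `hasCM_iff_j_mem` (Silverman *AEC*
C.11.3.1–2), every CM elliptic curve over `ℚ` is joined by a `ℚ`-isogeny with local points maps
and unchanged `L`-function to one with CM by the maximal order (the identity if `j(E)` is already
a maximal-order value). [cite: SilvermanAdvancedTopics1994, Exercise 2.12(b)]
[cite: SilvermanAEC2009, App. C §11, Example C.11.3.1–3.2] -/
theorem exists_isLocIsogenous_LFunction_eq_j_mem_maximalCMJInvariants_of_hasCM_of_hasCM_iff_j_mem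
    (h13 : hasCM_iff_j_mem) (W : WeierstrassCurve ℚ) [W.IsElliptic] (hCM : W.HasCM) :
    ∃ (W' : WeierstrassCurve ℚ) (_ : W'.IsElliptic),
      IsLocIsogenous W W' ∧ W.LFunction = W'.LFunction ∧ W'.j ∈ maximalCMJInvariants := by
  by_cases hmax : W.j ∈ maximalCMJInvariants
  · exact ⟨W, ‹W.IsElliptic›, IsLocIsogenous.refl W, rfl, hmax⟩
  · exact exists_isLocIsogenous_LFunction_eq_j_mem_maximalCMJInvariants_of_j_mem_nonmaximalCMJInvariants
      W (mem_nonmaximalCMJInvariants_iff.2 ⟨(h13 W).1 hCM, hmax⟩)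

/-! ## Assembly -/

/-- **bsd.S28 (`Ш` part), `HasCM` form, from its maximal-order case and the classification of
rational CM `j`-invariants — the isogeny step fully proved.** For `E/ℚ` with CM and
`L(E/ℚ, 1) ≠ 0`: by `hasCM_iff_j_mem` (`h13`) and the table, `E` is joined by a `ℚ`-isogeny `φ`
with local points maps to `E'` with CM by `𝓞_K` and `L(E', s) = L(E, s)` (Knapp 11.67 for these
isogenies, proved), so `L(E', 1) ≠ 0`; `Ш(E'/ℚ)` is finite by the maximal-order case (`h9`);
hence `Ш(E/ℚ)` is finite (`IsLocIsogenous.shaFinite_of_shaFinite`: Milne, *ADT*, I.7.1(b),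
proved). Rubin's reduction (1987, §10, p. 548) over `ℚ`.
[cite: Rubin1987Sha, §0 Remark (3) and §10, p. 548] [cite: MilneADT2006, Ch. I Lemma 7.1(b)]
[cite: Knapp1993, Thm. 11.67] -/
theorem shaFinite_of_hasCM_of_L_one_ne_zero_of_maximalOrder_of_hasCM_iff_j_mem
    (h9 : shaFinite_of_j_mem_maximalCMJInvariants_of_L_one_ne_zero) (h13 : hasCM_iff_j_mem) :
    shaFinite_of_hasCM_of_L_one_ne_zero := by
  intro W _ hCM hL
  obtain ⟨W', hW', hiso, hLF, hj⟩ :=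
    exists_isLocIsogenous_LFunction_eq_j_mem_maximalCMJInvariants_of_hasCM_of_hasCM_iff_j_mem h13 W hCM
  haveI := hW'
  have hL' : W'.entireLFunction 1 ≠ 0 := by
    rwa [← entireLFunction_eq_of_LSeries_eq (LSeries_eq_of_LFunction_eq hLF)]
  exact hiso.shaFinite_of_shaFinite (h9 W' hj hL')

/-- **bsd.S28 (`Ш` part) after five levels of decomposition.**
`shaFinite_of_hasCM_of_L_one_ne_zero` (`E/ℚ` with CM and `L(E/ℚ, 1) ≠ 0 ⇒ Ш(E/ℚ)` finite;
Rubin 1987, §0 Remark (3)) follows, sorry-free, from five printed statements: Rubin's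
Theorem 6.6 (`h66`) and §10 (`h10`) for `E_K` (the two halves of Theorem A), Deuring's theorem
(`hD`), modularity (`hmod`) and the classification of rational CM `j`-invariants (`h13`).
Proved in the tree along the way: Theorem A from its halves, Remark (3) from Theorem A (base
change to the CM field), the explicit isogenies to maximal order with their local points maps,
the isogeny invariance of the finiteness of `Ш` along them (Milne I.7.1(b)) and of the
`L`-function (Knapp 11.67 for these isogeny classes and all their twists).
[cite: Rubin1987Sha, Thm. A, §0 Remark (3), Thm. 6.6 and §10]
[cite: MilneADT2006, Ch. I Lemma 7.1(b)] [cite: Knapp1993, Thm. 11.67] -/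
theorem shaFinite_of_hasCM_of_L_one_ne_zero_of_level5
    (h66 : Rubin1987_sha_torsionBy_eq_bot_cofinite) (h10 : Rubin1987_sha_primary_finite)
    (hD : Deuring_LFunction_baseChange_cmField) (hmod : hasEntireLFunction_rat)
    (h13 : hasCM_iff_j_mem) : shaFinite_of_hasCM_of_L_one_ne_zero :=
  shaFinite_of_hasCM_of_L_one_ne_zero_of_maximalOrder_of_hasCM_iff_j_mem
    (shaFinite_of_j_mem_maximalCMJInvariants_of_L_one_ne_zero_of_facts
      (Rubin1987_shaFinite_baseChange_cmField_of_level2 h66 h10) hD hmod) h13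

end Literature.NumberTheory.EllipticCurves

end
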